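import Literature.MathematicalPhysics.QuantumFieldTheory.Balaban1983to89.B9Eq325QGGQInvZdPer

/-!
# `Balaban1983to89.B9Eq325QGGQInvZdPerLevels` — [Balaban1985BackgroundPropagators] (3.23)–(3.25) p. 394 and Thm 3.11 p. 416 ON THE TORUS `T_P`
# WITH THE AVERAGED TRANSPORTERS UNITARY ONLY UP TO THE TRUNCATION LEVEL `m` — the hypothesis-exact edition of the (β′-PERIODIC) chain's form identity
# (`B9Eq324DeltaPrimeAZdPer.formPer_deltaPrimeAPer`), adjointness (`B9Eq325QGGQInvZdPer.formPer_qprimeStarPer`) and invertibility of `Q′G′(U₀)²Q′*`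
# (`qggqPer_bijective`), which asked `Ū₀ʲ(Γ)` unitary at EVERY level `j` although only the levels `j ≤ m` that `Q′ = (Q′_j)_{j≤m}` reads enter — so that the
# chain applies in [Balaban1985Averaging] Prop. 2's regime of a background controlled up to level `m` (`B7Prop2Explicit.avgIter_mem`: `Ū₀ʲ` unitary for `j ≤ k`)

statement-level skeleton of published theorems with citation tags; proofs where landed; nothing here is a claim about the
Yang–Mills mass gap

`[Balaban1985BackgroundPropagators]` ("B9", CMP **99** (1985) 389–434) p. 394 (3.23)–(3.25) with (3.18)–(3.19) p. 393: *«Q′ … the sequence of averaging operations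
Q′_j(U) = Q′(Ūʲ⁻¹)…Q′(Ū)Q′(U), j = 0, 1, …»* up to the number of steps of the procedure — only the averaged configurations `Ūʲ`, `j` below the truncation, occur;
`[Balaban1985Averaging]` Prop. 2 p. 26 gives their regularity (and, for unitary groups, their unitarity: (42)–(43) keep `U(N)`-values in the small-field regime)
exactly up to that level.  `[Balaban1985RegularSpaces]` p. 77 *«we admit the case when some domains Ω_j are equal to T_η»*.  PDF held:
`paper:balaban1985-cmp99-background-propagators` pp. 393–394, 416 (re-read by this seat, 2026-08-28).

CITATION HEADER (lean-in-tree rule).  Cell `pub-ymgap` (YM Track A, HUMAN RULING D-0062 ∕ D-0149 width push), DAG node N06 = [B9], width seat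
`pub-ymgap-dag-n06-w4` (g6); a HYPOTHESIS-WEAKENING re-edition of this seat's own files `B9Eq321LandauOrthogonalZdPer` (§2 transposes), `B9Eq324DeltaPrimeAZdPer`
(§2 form) and `B9Eq325QGGQInvZdPer` (§2–§4), exactly as the lineage's g3 did at the `ℤᵈ` members (`B9Eq325ProjFormulaZdLevels`); needed by the near-flat road on
the torus (`B9Thm311PosDefOpenZdPer`, `B9Eq324NearFlatFormComparisonZdPer`): there the background ranges over a small-field class controlling the averages `Ū₀ʲ`
only for `j ≤ m`.  Every proof below is the all-levels proof with the level bound threaded through; the lemmas not involving the transporters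
(`sum_box_pair_qprimeT1`, `sum_box_pair_covLap_eq_sum`, `formPer_GpPer_symm`, `GpPer_injective`, `qggqPer_cPer`, …) are cited BY NAME, nothing restated.

WHAT IS PROVED (kernel, 0 sorry; theorems only).  With `hT : ∀ j, j ≤ m → ∀ z y, bgT L U₀ j z y ∈ S` (resp. `∈ unitaryUnits 𝔸`) in place of the all-levels hypothesis:
* §1 `sum_box_pair_QprimeT_le` (the cell transpose of `Q′_j` for `Lʲ ∣ P` with the transporters in `S` below `j`) · `sum_box_pair_QT_le` (the level sum, `Lᵐ ∣ P`).
* §2 ★★ `formPer_deltaPrimeAPer_le` (THE QUADRATIC FORM (3.23)–(3.24) ON THE CELL) · `formPer_deltaPrimeAPer_symm_le` · `formPer_deltaPrimeAPer_self_nonneg_le` ·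
  `covDerivFwd_eq_zero_of_form_eq_zero_le` · `qprimeIter_eq_zero_of_form_eq_zero_le` (the kernel of the form).
* §3 ★★ `formPer_qprimeStarPer_le` (ADJOINTNESS `⟨Q′*φ, f⟩_{T_P} = ⟨φ, Q′f⟩_{𝔅_P}`) · `levFormPer_qggqPer_self_le` · `levFormPer_qggqPer_self_nonneg_le` ·
  `levFormPer_qggqPer_symm_le` · `levFormPer_qggqPer_self_eq_zero_le` · ★★★ `qggqPer_bijective_le` (THM 3.11's third operator on the torus, in the regime) ·
  `levFormPer_cPer_self_pos_le` · `levFormPer_cPer_symm_le`.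

HONEST SCOPE.  Algebra only (the same computations as the all-levels files); no estimate; count-neutral; N05 ∕ N06 NOT discharged; K1⁹ `stmt-QuantumFields-27364`
NOT closed; one finite `𝕋⁴` programme at fixed `ε`, Bałaban as printed; R4 closes only the conditional finite-`𝕋⁴` rung `BalabanLadder.UV` — nothing continuum ∕
ℝ⁴ ∕ OS ∕ mass gap ∕ Clay.  Unit `pub-ymgap-dag-n06-w4` (g6), 2026-08-28.
-/

noncomputable section

namespace Literature.MathematicalPhysics.QuantumFieldTheory.Balaban1983to89.B9Eq325QGGQInvZdPerLevels

open B7Prop1Explicit B7Eq78Linearization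
open B7Prop2Explicit (unitaryUnits)
open B8Ineq132 (covDerivFwd)
open B8Eq119TwistedAxial (bgT)
open B8Eq138LandauZd (covLap qprimeT1 QprimeT QT)
open T4TermwiseTorus (IsPeriodic box mem_box tlift tlift_mem_box)
open B9Eq321LandauProjectionZdPer (perSub formPer formPer_apply formPer_isSymm formPer_apply_self_eq_zero)
open B9Eq321LandauOrthogonalZdPer (sum_box_pair_qprimeT1 sum_box_pair_covLap_eq_sum)
open B9Eq324DeltaPrimeAZd (fibreForm fibreForm_apply fibreForm_comm fibreForm_invariant)
open B9Eq324DeltaPrimeAZdPer (penaltyMult deltaPrimeAPerFun_apply deltaPrimeAPer deltaPrimeAPer_coe_apply_of_mem_box GpPer RegularPrimePer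
  deltaPrimeAPer_GpPer GpPer_injective formPer_GpPer_symm)
open B9Eq325QGGQInvZdPer (InSat levPer levFormPer levFormPer_apply levFormPer_isSymm neZero_div_pow finiteDimensional_levPer QprimeVecPer
  QprimeVecPer_apply_of_mem_box QprimeVecPer_apply_of_not QprimeStarPer QprimeStarPer_coe_apply_of_mem_box qggqPer qggqPer_apply QprimeStarPerInjective
  cPer qggqPer_cPer)

-- `Site` alone could resolve to the torus sites of `Setup.lean`; re-export the `ℤ^d` sites of `B7Prop1Explicit`.
export B7Prop1Explicit (Site)

variable {d : ℕ} {𝔸 : Type*} [CStarAlgebra 𝔸]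

/-- each diagonal term `Re τ(b* b)` is non-negative for a faithful positive trace. [folklore] -/
private theorem re_trace_star_mul_self_nonneg (τ : 𝔸 →ₗ[ℂ] ℂ) (hτp : ∀ a : 𝔸, a ≠ 0 → 0 < (τ (star a * a)).re) (b : 𝔸) :
    0 ≤ (τ (star b * b)).re := by
  by_cases hb : b = 0
  · rw [hb, mul_zero, map_zero, Complex.zero_re]
  · exact (hτp b hb).le

/-! ## §1  The cell transposes of `Q′_j(U₀)` and `Q′(U₀)` with the transporters in `S` only below the level read -/

section Transposes

variable {V : Type*} [AddCommGroup V] [Module ℝ V] (B : 𝔸 →ₗ[ℝ] 𝔸 →ₗ[ℝ] V) (S : Subgroup 𝔸ˣ)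
variable (L : ℕ) [NeZero L] (U₀ : Site d → Fin d → 𝔸ˣ)

/-- ★ **THE ITERATED TRANSPOSE ON THE CELL, LEVELS BELOW `j` ONLY**: for `Lʲ ∣ P` and the transporters `Ū₀ⁱ(Γ) ∈ S` for `i < j`,
`Σ_{x ∈ [0,P)ᵈ} B(g(x), (Q′_jᵀν)(x)) = Σ_{y ∈ [0,P∕Lʲ)ᵈ} B((Q′_j(U₀)g)(y), ν(y))` ((3.19): `Q′_j(U) = Q′(Ūʲ⁻¹)⋯Q′(U)` reads `Ū⁰, …, Ūʲ⁻¹` only).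
[cite: Balaban1985BackgroundPropagators, (3.19) p.393; Balaban1985RegularSpaces, (1.29) p.81, p.77 («Ω_j = T_η»)] -/
theorem sum_box_pair_QprimeT_le (hB : ∀ u ∈ S, ∀ a b : 𝔸, B (conjR u a) b = B a (conjR u⁻¹ b)) :
    ∀ (j : ℕ) (_ : ∀ i, i < j → ∀ (z y : Site d), bgT L U₀ i z y ∈ S) {P : ℕ} (_ : L ^ j ∣ P) (g ν : Site d → 𝔸),
      ∑ x ∈ box (d := d) P, B (g x) (QprimeT L U₀ j ν x) =
        ∑ y ∈ box (d := d) (P / L ^ j), B (QprimeIter (zdBlocking d L) (bgT L U₀) j g y) (ν y) := by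
  intro j
  induction j with
  | zero =>
    intro _ P _ g ν
    simp only [pow_zero, Nat.div_one]
    rfl
  | succ j ih =>
    intro hT P hP g ν
    have hPj : L ^ j ∣ P := (pow_dvd_pow L (Nat.le_succ j)).trans hP
    have hdiv : L ∣ P / L ^ j := by
      obtain ⟨c, rfl⟩ := hP
      refine ⟨c, ?_⟩
      have hLj : 0 < L ^ j := pow_pos (Nat.pos_of_ne_zero (NeZero.ne L)) j
      rw [pow_succ, mul_assoc, Nat.mul_div_cancel_left _ hLj]
    have hT' : ∀ i, i < j → ∀ (z y : Site d), bgT L U₀ i z y ∈ S := fun i hi => hT i (Nat.lt_succ_of_lt hi)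
    show ∑ x ∈ box P, B (g x) (QprimeT L U₀ j (qprimeT1 L U₀ j ν) x) = _
    rw [ih hT' hPj g (qprimeT1 L U₀ j ν), sum_box_pair_qprimeT1 B S L U₀ hB j (hT j (Nat.lt_succ_self j)) hdiv, Nat.div_div_eq_div_mul,
      ← pow_succ]
    rfl

/-- **THE LEVEL SUM ON THE CELL, TRANSPORTERS IN `S` UP TO THE TRUNCATION**: for `Lᵐ ∣ P` and `Ū₀ʲ(Γ) ∈ S` for `j ≤ m`,
`Σ_{x∈[0,P)ᵈ} B(g(x), (Q′(U₀)ᵀμ)(x)) = Σ_{j ≤ m} Σ_{y∈[0,P∕Lʲ)ᵈ} B((Q′_j(U₀)g)(y), 𝟙_{Λ_j}(y)μ_j(y))` ((3.24): the levels `j = 0, …, m`).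
[cite: Balaban1985BackgroundPropagators, (3.24) p.394, (3.19) p.393; Balaban1985RegularSpaces, (1.38) p.82] -/
theorem sum_box_pair_QT_le (hB : ∀ u ∈ S, ∀ a b : 𝔸, B (conjR u a) b = B a (conjR u⁻¹ b)) {m : ℕ}
    (hT : ∀ j, j ≤ m → ∀ (z y : Site d), bgT L U₀ j z y ∈ S) {P : ℕ} (hP : L ^ m ∣ P) (g : Site d → 𝔸)
    (Λs : ℕ → Set (Site d)) (μ : ℕ → Site d → 𝔸) :
    ∑ x ∈ box (d := d) P, B (g x) (QT L m Λs U₀ μ x) =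
      ∑ j ∈ Finset.range (m + 1), ∑ y ∈ box (d := d) (P / L ^ j),
        B (QprimeIter (zdBlocking d L) (bgT L U₀) j g y) ((Λs j).indicator (μ j) y) := by
  have h1 : ∀ x, B (g x) (QT L m Λs U₀ μ x) = ∑ j ∈ Finset.range (m + 1), B (g x) (QprimeT L U₀ j ((Λs j).indicator (μ j)) x) := by
    intro x
    simp only [QT, map_sum]
  simp only [h1]
  rw [Finset.sum_comm]
  refine Finset.sum_congr rfl fun j hj => ?_
  have hjm : j ≤ m := Nat.lt_succ_iff.1 (Finset.mem_range.1 hj)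
  exact sum_box_pair_QprimeT_le B S L U₀ hB j (fun i hi => hT i ((le_of_lt hi).trans hjm)) ((pow_dvd_pow L hjm).trans hP) g _

end Transposes

/-! ## §2  The quadratic form (3.23)–(3.24) on the cell with the transporters unitary up to level `m`; symmetry; positivity; kernel -/

section Form

variable (τ : 𝔸 →ₗ[ℂ] ℂ) {L : ℕ} [NeZero L] {U₀ : Site d → Fin d → 𝔸ˣ} {η : ℝ} {m : ℕ} {a : ℕ → ℝ} {Λs : ℕ → Set (Site d)} {P : ℕ} [NeZero P]

/-- ★★ **THE QUADRATIC FORM (3.23)–(3.24) ON THE CELL, TRANSPORTERS UNITARY FOR `j ≤ m`**: at a UNITARY `P`-periodic background, tracial `τ`, `Lᵐ ∣ P`, periodic `f, g`: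
`⟨g, Δ′_a(U₀)f⟩_{T_P} = Σ_μ Σ_{x∈[0,P)ᵈ} Re τ((D^η_{U₀,μ}g)(x)* (D^η_{U₀,μ}f)(x)) + Σ_{j ≤ m} Σ_{y∈[0,P∕Lʲ)ᵈ} 𝟙_{Λ_j}(y)·a_j·Re τ((Q′_jg)(y)* (Q′_jf)(y))`.
[cite: Balaban1985BackgroundPropagators, (3.23)–(3.24) p.394, (3.19) p.393; Balaban1985RegularSpaces, p.77 («Ω_j = T_η»)] -/
theorem formPer_deltaPrimeAPer_le (hτt : ∀ a b : 𝔸, τ (a * b) = τ (b * a))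
    (hUu : ∀ (x : Site d) (κ : Fin d), U₀ x κ ∈ unitaryUnits 𝔸) (hT : ∀ j, j ≤ m → ∀ (z y : Site d), bgT L U₀ j z y ∈ unitaryUnits 𝔸)
    (hU : IsPeriodic P U₀) (hP : L ^ m ∣ P) (f g : perSub (𝔸 := 𝔸) (d := d) P) :
    formPer τ P g (deltaPrimeAPer L U₀ η m a Λs P f) =
      (∑ μ : Fin d, ∑ x ∈ box (d := d) P, (τ (star (covDerivFwd η U₀ μ (g : Site d → 𝔸) x) * covDerivFwd η U₀ μ (f : Site d → 𝔸) x)).re) +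
        ∑ j ∈ Finset.range (m + 1), ∑ y ∈ box (d := d) (P / L ^ j),
          (Λs j).indicator (fun y => a j * (τ (star (QprimeIter (zdBlocking d L) (bgT L U₀) j (g : Site d → 𝔸) y) *
            QprimeIter (zdBlocking d L) (bgT L U₀) j (f : Site d → 𝔸) y)).re) y := by
  rw [formPer_apply]
  have h0 : ∀ x ∈ box (d := d) P, (τ (star ((g : Site d → 𝔸) x) * (deltaPrimeAPer L U₀ η m a Λs P f : Site d → 𝔸) x)).re =
      fibreForm τ ((g : Site d → 𝔸) x) (covLap η U₀ (f : Site d → 𝔸) x) +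
        fibreForm τ ((g : Site d → 𝔸) x) (QT L m Λs U₀ (penaltyMult L U₀ a (f : Site d → 𝔸)) x) := by
    intro x hx
    rw [deltaPrimeAPer_coe_apply_of_mem_box L U₀ η m a Λs P f hx, deltaPrimeAPerFun_apply, fibreForm_apply, fibreForm_apply, mul_add, map_add,
      Complex.add_re]
  rw [Finset.sum_congr rfl h0, Finset.sum_add_distrib]
  have hB := fibreForm_invariant τ hτt
  congr 1
  · rw [sum_box_pair_covLap_eq_sum (fibreForm τ) (unitaryUnits 𝔸) P η U₀ hB hUu hU f.2 g.2]
    simp only [fibreForm_apply]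
  · rw [sum_box_pair_QT_le (fibreForm τ) (unitaryUnits 𝔸) L U₀ hB hT hP (g : Site d → 𝔸) Λs (penaltyMult L U₀ a (f : Site d → 𝔸))]
    refine Finset.sum_congr rfl fun j _ => Finset.sum_congr rfl fun y _ => ?_
    by_cases hy : y ∈ Λs j
    · simp only [Set.indicator_of_mem hy, penaltyMult, LinearMap.map_smul, fibreForm_apply, smul_eq_mul]
    · simp only [Set.indicator_of_notMem hy, map_zero]

/-- **SYMMETRY**: `⟨g, Δ′_a f⟩ = ⟨f, Δ′_a g⟩` on `L²(T_P, ·)` (same hypotheses, Hermitian `τ`). [cite: Balaban1985BackgroundPropagators, (3.24) p.394 (a symmetric operator)] -/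
theorem formPer_deltaPrimeAPer_symm_le (hτt : ∀ a b : 𝔸, τ (a * b) = τ (b * a)) (hτs : ∀ a : 𝔸, τ (star a) = starRingEnd ℂ (τ a))
    (hUu : ∀ (x : Site d) (κ : Fin d), U₀ x κ ∈ unitaryUnits 𝔸) (hT : ∀ j, j ≤ m → ∀ (z y : Site d), bgT L U₀ j z y ∈ unitaryUnits 𝔸)
    (hU : IsPeriodic P U₀) (hP : L ^ m ∣ P) (f g : perSub (𝔸 := 𝔸) (d := d) P) :
    formPer τ P g (deltaPrimeAPer L U₀ η m a Λs P f) = formPer τ P f (deltaPrimeAPer L U₀ η m a Λs P g) := by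
  rw [formPer_deltaPrimeAPer_le τ hτt hUu hT hU hP f g, formPer_deltaPrimeAPer_le τ hτt hUu hT hU hP g f]
  congr 1
  · refine Finset.sum_congr rfl fun μ _ => Finset.sum_congr rfl fun x _ => ?_
    exact fibreForm_comm τ hτs _ _
  · refine Finset.sum_congr rfl fun j _ => Finset.sum_congr rfl fun y _ => ?_
    by_cases hy : y ∈ Λs j
    · rw [Set.indicator_of_mem hy, Set.indicator_of_mem hy]
      have h := fibreForm_comm τ hτs (QprimeIter (zdBlocking d L) (bgT L U₀) j (g : Site d → 𝔸) y)
        (QprimeIter (zdBlocking d L) (bgT L U₀) j (f : Site d → 𝔸) y)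
      rw [fibreForm_apply, fibreForm_apply] at h
      rw [h]
    · rw [Set.indicator_of_notMem hy, Set.indicator_of_notMem hy]

/-- **POSITIVITY**: `⟨f, Δ′_a f⟩ ≥ 0` for `a ≥ 0` and a faithful `τ` (same hypotheses). [cite: Balaban1985BackgroundPropagators, Thm 3.11 p.416 («positive definite … obvious for the first three operators»)] -/
theorem formPer_deltaPrimeAPer_self_nonneg_le (hτt : ∀ a b : 𝔸, τ (a * b) = τ (b * a))
    (hτp : ∀ a : 𝔸, a ≠ 0 → 0 < (τ (star a * a)).re)
    (hUu : ∀ (x : Site d) (κ : Fin d), U₀ x κ ∈ unitaryUnits 𝔸) (hT : ∀ j, j ≤ m → ∀ (z y : Site d), bgT L U₀ j z y ∈ unitaryUnits 𝔸)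
    (hU : IsPeriodic P U₀) (hP : L ^ m ∣ P) (ha : ∀ j, 0 ≤ a j) (f : perSub (𝔸 := 𝔸) (d := d) P) :
    0 ≤ formPer τ P f (deltaPrimeAPer L U₀ η m a Λs P f) := by
  rw [formPer_deltaPrimeAPer_le τ hτt hUu hT hU hP f f]
  refine add_nonneg (Finset.sum_nonneg fun μ _ => Finset.sum_nonneg fun x _ => re_trace_star_mul_self_nonneg τ hτp _)
    (Finset.sum_nonneg fun j _ => Finset.sum_nonneg fun y _ => ?_)
  by_cases hy : y ∈ Λs j
  · rw [Set.indicator_of_mem hy]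
    exact mul_nonneg (ha j) (re_trace_star_mul_self_nonneg τ hτp _)
  · rw [Set.indicator_of_notMem hy]

/-- ★ **THE KERNEL OF THE FORM, LAPLACIAN PART** (transporters unitary for `j ≤ m`): `⟨f, Δ′_a f⟩ = 0` (with `a ≥ 0`) forces `D^η_{U₀,μ}f = 0` at every site.
[cite: Balaban1985BackgroundPropagators, (3.23)–(3.24) p.394, Thm 3.11 p.416] -/
theorem covDerivFwd_eq_zero_of_form_eq_zero_le (hτt : ∀ a b : 𝔸, τ (a * b) = τ (b * a))
    (hτp : ∀ a : 𝔸, a ≠ 0 → 0 < (τ (star a * a)).re)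
    (hUu : ∀ (x : Site d) (κ : Fin d), U₀ x κ ∈ unitaryUnits 𝔸) (hT : ∀ j, j ≤ m → ∀ (z y : Site d), bgT L U₀ j z y ∈ unitaryUnits 𝔸)
    (hU : IsPeriodic P U₀) (hP : L ^ m ∣ P) (ha : ∀ j, 0 ≤ a j) {f : perSub (𝔸 := 𝔸) (d := d) P}
    (h0 : formPer τ P f (deltaPrimeAPer L U₀ η m a Λs P f) = 0) (μ : Fin d) (x : Site d) :
    covDerivFwd η U₀ μ (f : Site d → 𝔸) x = 0 := by
  rw [formPer_deltaPrimeAPer_le τ hτt hUu hT hU hP f f] at h0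
  have hD : ∀ μ, 0 ≤ ∑ x ∈ box (d := d) P, (τ (star (covDerivFwd η U₀ μ (f : Site d → 𝔸) x) * covDerivFwd η U₀ μ (f : Site d → 𝔸) x)).re :=
    fun μ => Finset.sum_nonneg fun x _ => re_trace_star_mul_self_nonneg τ hτp _
  have hQ : 0 ≤ ∑ j ∈ Finset.range (m + 1), ∑ y ∈ box (d := d) (P / L ^ j),
      (Λs j).indicator (fun y => a j * (τ (star (QprimeIter (zdBlocking d L) (bgT L U₀) j (f : Site d → 𝔸) y) *
        QprimeIter (zdBlocking d L) (bgT L U₀) j (f : Site d → 𝔸) y)).re) y := by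
    refine Finset.sum_nonneg fun j _ => Finset.sum_nonneg fun y _ => ?_
    by_cases hy : y ∈ Λs j
    · rw [Set.indicator_of_mem hy]; exact mul_nonneg (ha j) (re_trace_star_mul_self_nonneg τ hτp _)
    · rw [Set.indicator_of_notMem hy]
  have hDsum : ∑ μ : Fin d, ∑ x ∈ box (d := d) P,
      (τ (star (covDerivFwd η U₀ μ (f : Site d → 𝔸) x) * covDerivFwd η U₀ μ (f : Site d → 𝔸) x)).re = 0 := by
    have := Finset.sum_nonneg fun μ (_ : μ ∈ (Finset.univ : Finset (Fin d))) => hD μ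
    linarith
  have hμ := (Finset.sum_eq_zero_iff_of_nonneg fun μ _ => hD μ).1 hDsum μ (Finset.mem_univ _)
  have hcell : ∀ y ∈ box (d := d) P, covDerivFwd η U₀ μ (f : Site d → 𝔸) y = 0 := by
    intro y hy
    by_contra hne
    have := (Finset.sum_eq_zero_iff_of_nonneg fun z _ => re_trace_star_mul_self_nonneg τ hτp _).1 hμ y hy
    exact (hτp _ hne).ne' this
  have hper : IsPeriodic P (covDerivFwd η U₀ μ (f : Site d → 𝔸)) :=
    B9Eq321LandauProjectionZdPer.isPeriodic_covDerivFwd hU f.2 μ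
  rw [← IsPeriodic.apply_tlift hper x]
  exact hcell _ (tlift_mem_box _)

/-- ★ **THE KERNEL OF THE FORM, AVERAGING PART** (transporters unitary for `j ≤ m`): `⟨f, Δ′_a f⟩ = 0` (with `a ≥ 0`) forces `(Q′_j(U₀)f)(y) = 0` at every constraint
point `y ∈ Λ_j` of the level-`j` cell with `a_j > 0`. [cite: Balaban1985BackgroundPropagators, (3.24) p.394, Thm 3.11 p.416] -/
theorem qprimeIter_eq_zero_of_form_eq_zero_le (hτt : ∀ a b : 𝔸, τ (a * b) = τ (b * a))
    (hτp : ∀ a : 𝔸, a ≠ 0 → 0 < (τ (star a * a)).re)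
    (hUu : ∀ (x : Site d) (κ : Fin d), U₀ x κ ∈ unitaryUnits 𝔸) (hT : ∀ j, j ≤ m → ∀ (z y : Site d), bgT L U₀ j z y ∈ unitaryUnits 𝔸)
    (hU : IsPeriodic P U₀) (hP : L ^ m ∣ P) (ha : ∀ j, 0 ≤ a j) {f : perSub (𝔸 := 𝔸) (d := d) P}
    (h0 : formPer τ P f (deltaPrimeAPer L U₀ η m a Λs P f) = 0) {j : ℕ} (hj : j ≤ m) (haj : 0 < a j) {y : Site d}
    (hy : y ∈ Λs j) (hyb : y ∈ box (d := d) (P / L ^ j)) :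
    QprimeIter (zdBlocking d L) (bgT L U₀) j (f : Site d → 𝔸) y = 0 := by
  rw [formPer_deltaPrimeAPer_le τ hτt hUu hT hU hP f f] at h0
  have hD : 0 ≤ ∑ μ : Fin d, ∑ x ∈ box (d := d) P,
      (τ (star (covDerivFwd η U₀ μ (f : Site d → 𝔸) x) * covDerivFwd η U₀ μ (f : Site d → 𝔸) x)).re :=
    Finset.sum_nonneg fun μ _ => Finset.sum_nonneg fun x _ => re_trace_star_mul_self_nonneg τ hτp _
  have hterm : ∀ j' y', 0 ≤ (Λs j').indicator (fun y => a j' * (τ (star (QprimeIter (zdBlocking d L) (bgT L U₀) j' (f : Site d → 𝔸) y) *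
      QprimeIter (zdBlocking d L) (bgT L U₀) j' (f : Site d → 𝔸) y)).re) y' := by
    intro j' y'
    by_cases hy' : y' ∈ Λs j'
    · rw [Set.indicator_of_mem hy']; exact mul_nonneg (ha j') (re_trace_star_mul_self_nonneg τ hτp _)
    · rw [Set.indicator_of_notMem hy']
  have hQ : 0 ≤ ∑ j ∈ Finset.range (m + 1), ∑ y ∈ box (d := d) (P / L ^ j),
      (Λs j).indicator (fun y => a j * (τ (star (QprimeIter (zdBlocking d L) (bgT L U₀) j (f : Site d → 𝔸) y) *
        QprimeIter (zdBlocking d L) (bgT L U₀) j (f : Site d → 𝔸) y)).re) y :=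
    Finset.sum_nonneg fun j _ => Finset.sum_nonneg fun y _ => hterm j y
  have hQsum : ∑ j ∈ Finset.range (m + 1), ∑ y ∈ box (d := d) (P / L ^ j),
      (Λs j).indicator (fun y => a j * (τ (star (QprimeIter (zdBlocking d L) (bgT L U₀) j (f : Site d → 𝔸) y) *
        QprimeIter (zdBlocking d L) (bgT L U₀) j (f : Site d → 𝔸) y)).re) y = 0 := by linarith
  have hj' : j ∈ Finset.range (m + 1) := Finset.mem_range.2 (Nat.lt_succ_of_le hj)
  have hlev := (Finset.sum_eq_zero_iff_of_nonneg fun j _ => Finset.sum_nonneg fun y _ => hterm j y).1 hQsum j hj'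
  have hpt := (Finset.sum_eq_zero_iff_of_nonneg fun y _ => hterm j y).1 hlev y hyb
  rw [Set.indicator_of_mem hy] at hpt
  by_contra hne
  have hpos := mul_pos haj (hτp _ hne)
  exact hpos.ne' hpt

end Form

/-! ## §3  Adjointness `⟨Q′*φ, f⟩ = ⟨φ, Q′f⟩`, the form of `Q′G′²Q′*`, and Thm 3.11's third operator, with the transporters unitary up to level `m` -/

section QGGQ

variable (τ : 𝔸 →ₗ[ℂ] ℂ) {P L : ℕ} {U₀ : Site d → Fin d → 𝔸ˣ} {η : ℝ} {m : ℕ} {a : ℕ → ℝ} {Λs : ℕ → Set (Site d)} [NeZero P] [NeZero L]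

/-- ★★ **ADJOINTNESS ON THE CELL, TRANSPORTERS UNITARY FOR `j ≤ m`: `⟨Q′*φ, f⟩_{T_P} = ⟨φ, Q′f⟩_{𝔅_P}`** for EVERY background `U₀` whose averaged transporters
`Ū₀ʲ(Γ)`, `j ≤ m`, are unitary, `Lᵐ ∣ P`, `P ≠ 0`, tracial Hermitian `τ` (no periodicity of `U₀` or `f` needed).
[cite: Balaban1985BackgroundPropagators, (3.25) p.394, p.391 («The adjoints are taken with respect to natural L² scalar products»), (3.19) p.393] -/
theorem formPer_qprimeStarPer_le (hτt : ∀ a b : 𝔸, τ (a * b) = τ (b * a)) (hτs : ∀ a : 𝔸, τ (star a) = starRingEnd ℂ (τ a))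
    (hT : ∀ j, j ≤ m → ∀ (z y : Site d), bgT L U₀ j z y ∈ unitaryUnits 𝔸) (hP : L ^ m ∣ P)
    (φ : levPer (𝔸 := 𝔸) (d := d) P L m Λs) (f : perSub (𝔸 := 𝔸) (d := d) P) :
    formPer τ P (QprimeStarPer P L U₀ m Λs φ) f = levFormPer τ P L m Λs φ (QprimeVecPer P L U₀ m Λs f) := by
  rw [formPer_apply, levFormPer_apply]
  have h1 : ∀ x ∈ box (d := d) P, (τ (star ((QprimeStarPer P L U₀ m Λs φ : Site d → 𝔸) x) * (f : Site d → 𝔸) x)).re =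
      fibreForm τ ((f : Site d → 𝔸) x) (QT L m (fun _ => (Set.univ : Set (Site d))) U₀ (fun j y => (φ : ℕ × Site d → 𝔸) (j, y)) x) := by
    intro x hx
    rw [QprimeStarPer_coe_apply_of_mem_box P L U₀ m Λs φ hx, ← fibreForm_apply, fibreForm_comm τ hτs]
  rw [Finset.sum_congr rfl h1, sum_box_pair_QT_le (fibreForm τ) (unitaryUnits 𝔸) L U₀ (fibreForm_invariant τ hτt) hT hP (f : Site d → 𝔸)
    (fun _ => (Set.univ : Set (Site d))) (fun j y => (φ : ℕ × Site d → 𝔸) (j, y))]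
  refine Finset.sum_congr rfl fun j hj => Finset.sum_congr rfl fun y hy => ?_
  have hjm : j ≤ m := Nat.lt_succ_iff.1 (Finset.mem_range.1 hj)
  haveI := neZero_div_pow (P := P) hP hjm
  rw [Set.indicator_univ, fibreForm_comm τ hτs, fibreForm_apply]
  by_cases hsat : InSat P L Λs j y
  · rw [QprimeVecPer_apply_of_mem_box P L U₀ m Λs f hjm hy hsat]
  · rw [QprimeVecPer_apply_of_not P L U₀ m Λs f (fun h => hsat h.2), φ.2.2 (j, y) (fun h => hsat h.2)]
    simp

/-- ★★ **`⟨φ, Q′G′²Q′*φ⟩ = ⟨G′Q′*φ, G′Q′*φ⟩`** in the regime (`Δ′_a(U₀)` invertible), at a unitary periodic `U₀` with `Ū₀ʲ(Γ)` unitary for `j ≤ m`, `Lᵐ ∣ P`, tracial Hermitian `τ`.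
[cite: Balaban1985BackgroundPropagators, (3.25) p.394, Thm 3.11 p.416 («positive definite. This is obvious»)] -/
theorem levFormPer_qggqPer_self_le (hτt : ∀ a b : 𝔸, τ (a * b) = τ (b * a)) (hτs : ∀ a : 𝔸, τ (star a) = starRingEnd ℂ (τ a))
    (hUu : ∀ (x : Site d) (κ : Fin d), U₀ x κ ∈ unitaryUnits 𝔸) (hT : ∀ j, j ≤ m → ∀ (z y : Site d), bgT L U₀ j z y ∈ unitaryUnits 𝔸)
    (hU : IsPeriodic P U₀) (hP : L ^ m ∣ P) (hreg : RegularPrimePer L U₀ η m a Λs P) (φ : levPer (𝔸 := 𝔸) (d := d) P L m Λs) :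
    levFormPer τ P L m Λs φ (qggqPer P L U₀ η m a Λs φ) =
      formPer τ P (GpPer L U₀ η m a Λs P (QprimeStarPer P L U₀ m Λs φ)) (GpPer L U₀ η m a Λs P (QprimeStarPer P L U₀ m Λs φ)) := by
  rw [qggqPer_apply, ← formPer_qprimeStarPer_le τ hτt hτs hT hP,
    formPer_GpPer_symm τ hτs hreg (fun f g => formPer_deltaPrimeAPer_symm_le τ hτt hτs hUu hT hU hP f g)]

/-- **`⟨φ, Q′G′²Q′*φ⟩ ≥ 0`** (same hypotheses, faithful `τ`). [cite: Balaban1985BackgroundPropagators, Thm 3.11 p.416] -/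
theorem levFormPer_qggqPer_self_nonneg_le (hτt : ∀ a b : 𝔸, τ (a * b) = τ (b * a)) (hτs : ∀ a : 𝔸, τ (star a) = starRingEnd ℂ (τ a))
    (hτp : ∀ a : 𝔸, a ≠ 0 → 0 < (τ (star a * a)).re)
    (hUu : ∀ (x : Site d) (κ : Fin d), U₀ x κ ∈ unitaryUnits 𝔸) (hT : ∀ j, j ≤ m → ∀ (z y : Site d), bgT L U₀ j z y ∈ unitaryUnits 𝔸)
    (hU : IsPeriodic P U₀) (hP : L ^ m ∣ P) (hreg : RegularPrimePer L U₀ η m a Λs P) (φ : levPer (𝔸 := 𝔸) (d := d) P L m Λs) :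
    0 ≤ levFormPer τ P L m Λs φ (qggqPer P L U₀ η m a Λs φ) := by
  rw [levFormPer_qggqPer_self_le τ hτt hτs hUu hT hU hP hreg, formPer_apply]
  exact Finset.sum_nonneg fun x _ => re_trace_star_mul_self_nonneg τ hτp _

/-- **`Q′G′²Q′*` IS SYMMETRIC for the level pairing** (same hypotheses). [cite: Balaban1985BackgroundPropagators, (3.25) p.394] -/
theorem levFormPer_qggqPer_symm_le (hτt : ∀ a b : 𝔸, τ (a * b) = τ (b * a)) (hτs : ∀ a : 𝔸, τ (star a) = starRingEnd ℂ (τ a))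
    (hUu : ∀ (x : Site d) (κ : Fin d), U₀ x κ ∈ unitaryUnits 𝔸) (hT : ∀ j, j ≤ m → ∀ (z y : Site d), bgT L U₀ j z y ∈ unitaryUnits 𝔸)
    (hU : IsPeriodic P U₀) (hP : L ^ m ∣ P) (hreg : RegularPrimePer L U₀ η m a Λs P) (φ ψ : levPer (𝔸 := 𝔸) (d := d) P L m Λs) :
    levFormPer τ P L m Λs φ (qggqPer P L U₀ η m a Λs ψ) = levFormPer τ P L m Λs ψ (qggqPer P L U₀ η m a Λs φ) := by
  have hGs := formPer_GpPer_symm τ hτs hreg (fun f g => formPer_deltaPrimeAPer_symm_le τ hτt hτs hUu hT hU hP f g) (a := a) (η := η)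
  rw [qggqPer_apply, qggqPer_apply, ← formPer_qprimeStarPer_le τ hτt hτs hT hP, ← formPer_qprimeStarPer_le τ hτt hτs hT hP]
  set G := GpPer (𝔸 := 𝔸) (d := d) L U₀ η m a Λs P
  set u := QprimeStarPer P L U₀ m Λs φ
  set v := QprimeStarPer P L U₀ m Λs ψ
  rw [← hGs u (G v), (formPer_isSymm τ P hτs).eq (G u) (G v), hGs v (G u)]

/-- ★★ **`⟨φ, Q′G′²Q′*φ⟩ = 0 ⟹ φ = 0`** when `Q′*` is injective (in the regime; transporters unitary for `j ≤ m`).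
[cite: Balaban1985BackgroundPropagators, Thm 3.11 p.416 («(Q′G′²Q′*)⁻¹ … positive definite. This is obvious»)] -/
theorem levFormPer_qggqPer_self_eq_zero_le (hτt : ∀ a b : 𝔸, τ (a * b) = τ (b * a)) (hτs : ∀ a : 𝔸, τ (star a) = starRingEnd ℂ (τ a))
    (hτp : ∀ a : 𝔸, a ≠ 0 → 0 < (τ (star a * a)).re)
    (hUu : ∀ (x : Site d) (κ : Fin d), U₀ x κ ∈ unitaryUnits 𝔸) (hT : ∀ j, j ≤ m → ∀ (z y : Site d), bgT L U₀ j z y ∈ unitaryUnits 𝔸)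
    (hU : IsPeriodic P U₀) (hP : L ^ m ∣ P) (hreg : RegularPrimePer L U₀ η m a Λs P) (hinj : QprimeStarPerInjective P L U₀ m Λs)
    {φ : levPer (𝔸 := 𝔸) (d := d) P L m Λs} (h0 : levFormPer τ P L m Λs φ (qggqPer P L U₀ η m a Λs φ) = 0) : φ = 0 := by
  rw [levFormPer_qggqPer_self_le τ hτt hτs hUu hT hU hP hreg] at h0
  have hG : GpPer L U₀ η m a Λs P (QprimeStarPer P L U₀ m Λs φ) = 0 := formPer_apply_self_eq_zero τ P hτp h0
  have hQ : QprimeStarPer P L U₀ m Λs φ = 0 := GpPer_injective hreg (by rw [hG, map_zero])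
  exact hinj (by rw [hQ, map_zero])

/-- ★★★ **THEOREM 3.11, THIRD OPERATOR, ON THE TORUS, TRANSPORTERS UNITARY FOR `j ≤ m`: `Q′G′(U₀)²Q′*` IS INVERTIBLE ON `L²(𝔅_P, ·)`** in the regime, at a
unitary periodic `U₀`, given the injectivity of `Q′*` (`Lᵐ ∣ P`, `P ≠ 0`, tracial Hermitian faithful `τ`, finite-dimensional fibre).
[cite: Balaban1985BackgroundPropagators, Thm 3.11 p.416, (3.25) p.394 («if Δ′_a, Q′G′²Q′* are invertible. It will be proved later»)] -/
theorem qggqPer_bijective_le [FiniteDimensional ℝ 𝔸] (hτt : ∀ a b : 𝔸, τ (a * b) = τ (b * a)) (hτs : ∀ a : 𝔸, τ (star a) = starRingEnd ℂ (τ a))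
    (hτp : ∀ a : 𝔸, a ≠ 0 → 0 < (τ (star a * a)).re)
    (hUu : ∀ (x : Site d) (κ : Fin d), U₀ x κ ∈ unitaryUnits 𝔸) (hT : ∀ j, j ≤ m → ∀ (z y : Site d), bgT L U₀ j z y ∈ unitaryUnits 𝔸)
    (hU : IsPeriodic P U₀) (hP : L ^ m ∣ P) (hreg : RegularPrimePer L U₀ η m a Λs P) (hinj : QprimeStarPerInjective P L U₀ m Λs) :
    Function.Bijective (qggqPer (𝔸 := 𝔸) (d := d) P L U₀ η m a Λs) := by
  haveI := finiteDimensional_levPer (𝔸 := 𝔸) (d := d) P L m Λs hP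
  have hinj' : Function.Injective (qggqPer (𝔸 := 𝔸) (d := d) P L U₀ η m a Λs) := by
    rw [← LinearMap.ker_eq_bot, Submodule.eq_bot_iff]
    intro φ hφ
    rw [LinearMap.mem_ker] at hφ
    refine levFormPer_qggqPer_self_eq_zero_le τ hτt hτs hτp hUu hT hU hP hreg hinj ?_
    rw [hφ, map_zero]
  exact ⟨hinj', LinearMap.injective_iff_surjective.1 hinj'⟩

/-- ★ **`c(U₀)` IS POSITIVE DEFINITE** (transporters unitary for `j ≤ m`): `⟨cφ, φ⟩ = ‖G′Q′*cφ‖² > 0` for `φ ≠ 0`.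
[cite: Balaban1985BackgroundPropagators, Thm 3.11 p.416] -/
theorem levFormPer_cPer_self_pos_le [FiniteDimensional ℝ 𝔸] (hτt : ∀ a b : 𝔸, τ (a * b) = τ (b * a)) (hτs : ∀ a : 𝔸, τ (star a) = starRingEnd ℂ (τ a))
    (hτp : ∀ a : 𝔸, a ≠ 0 → 0 < (τ (star a * a)).re)
    (hUu : ∀ (x : Site d) (κ : Fin d), U₀ x κ ∈ unitaryUnits 𝔸) (hT : ∀ j, j ≤ m → ∀ (z y : Site d), bgT L U₀ j z y ∈ unitaryUnits 𝔸)
    (hU : IsPeriodic P U₀) (hP : L ^ m ∣ P) (hreg : RegularPrimePer L U₀ η m a Λs P) (hinj : QprimeStarPerInjective P L U₀ m Λs)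
    {φ : levPer (𝔸 := 𝔸) (d := d) P L m Λs} (hφ : φ ≠ 0) :
    0 < levFormPer τ P L m Λs (cPer P L U₀ η m a Λs φ) φ := by
  have hb := qggqPer_bijective_le τ hτt hτs hτp hUu hT hU hP hreg hinj (η := η) (a := a)
  have hne : cPer P L U₀ η m a Λs φ ≠ 0 := by
    intro h0
    apply hφ
    have := congrArg (qggqPer P L U₀ η m a Λs) h0
    rwa [qggqPer_cPer hb, map_zero] at this
  have key : levFormPer τ P L m Λs (cPer P L U₀ η m a Λs φ) φ =
      levFormPer τ P L m Λs (cPer P L U₀ η m a Λs φ) (qggqPer P L U₀ η m a Λs (cPer P L U₀ η m a Λs φ)) := by rw [qggqPer_cPer hb]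
  rw [key]
  have hnn := levFormPer_qggqPer_self_nonneg_le τ hτt hτs hτp hUu hT hU hP hreg (cPer P L U₀ η m a Λs φ)
  rcases hnn.lt_or_eq with hlt | heq
  · exact hlt
  · exact absurd (levFormPer_qggqPer_self_eq_zero_le τ hτt hτs hτp hUu hT hU hP hreg hinj heq.symm) hne

/-- `c(U₀)` IS SYMMETRIC for the level pairing (transporters unitary for `j ≤ m`). [cite: Balaban1985BackgroundPropagators, (3.25) p.394] -/
theorem levFormPer_cPer_symm_le [FiniteDimensional ℝ 𝔸] (hτt : ∀ a b : 𝔸, τ (a * b) = τ (b * a)) (hτs : ∀ a : 𝔸, τ (star a) = starRingEnd ℂ (τ a))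
    (hτp : ∀ a : 𝔸, a ≠ 0 → 0 < (τ (star a * a)).re)
    (hUu : ∀ (x : Site d) (κ : Fin d), U₀ x κ ∈ unitaryUnits 𝔸) (hT : ∀ j, j ≤ m → ∀ (z y : Site d), bgT L U₀ j z y ∈ unitaryUnits 𝔸)
    (hU : IsPeriodic P U₀) (hP : L ^ m ∣ P) (hreg : RegularPrimePer L U₀ η m a Λs P) (hinj : QprimeStarPerInjective P L U₀ m Λs)
    (φ ψ : levPer (𝔸 := 𝔸) (d := d) P L m Λs) :
    levFormPer τ P L m Λs (cPer P L U₀ η m a Λs φ) ψ = levFormPer τ P L m Λs φ (cPer P L U₀ η m a Λs ψ) := by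
  have hb := qggqPer_bijective_le τ hτt hτs hτp hUu hT hU hP hreg hinj (η := η) (a := a)
  have hsym := levFormPer_isSymm τ P L m Λs hτs
  calc levFormPer τ P L m Λs (cPer P L U₀ η m a Λs φ) ψ
      = levFormPer τ P L m Λs (cPer P L U₀ η m a Λs φ) (qggqPer P L U₀ η m a Λs (cPer P L U₀ η m a Λs ψ)) := by rw [qggqPer_cPer hb]
    _ = levFormPer τ P L m Λs (cPer P L U₀ η m a Λs ψ) (qggqPer P L U₀ η m a Λs (cPer P L U₀ η m a Λs φ)) :=
        levFormPer_qggqPer_symm_le τ hτt hτs hUu hT hU hP hreg _ _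
    _ = levFormPer τ P L m Λs (cPer P L U₀ η m a Λs ψ) φ := by rw [qggqPer_cPer hb]
    _ = levFormPer τ P L m Λs φ (cPer P L U₀ η m a Λs ψ) := hsym.eq _ _

end QGGQ

end Literature.MathematicalPhysics.QuantumFieldTheory.Balaban1983to89.B9Eq325QGGQInvZdPerLevels
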